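import Summits.AtomisticToContinuum.Crystallization.Theorems.ChargedEnergyGapSquareSumC
import Summits.AtomisticToContinuum.Crystallization.Theorems.ChargedEnergyGapBulkCarrier
import HarnessLib

/-!
(SPLIT FOR THE 400-LINE CAP by the landing lane, hand-2 g36: this file = part 1 of 2; sequels `…ChargedEnergyGapRoofCover` import it in a chain; same namespace, all FQNs unchanged.)
# Charged energy gap — NODE 76 «RoofCover»: the roof ledger (G_T) split along the TAME / CREASE dichotomy (lens-3 g76)

Beneath NODE 75's residual leaf (G_T) `RoofLedgerQ cls₀ …` (the F-ledger of the LP roof of the FIXED gauge `T75`; tree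
`…ChargedEnergyGapSquareSumC`) we type the door [SEMICONCAVE] through two field-free predicates of a shell octahedron `(y, z)` —

* `OctChiFree`  : no site of the octahedron is in transition for any listed set `Dᵢ` (then the localisation factor is CONSTANT `= 1` on a
  clean non-plateau octahedron — PROVED, `localFactor_eq_one_of_near`);
* `OctTame r_f` : the sites of the octahedron have nearest points ("feet") in `closure C` lying within `r_f` of each other (ONE feature seen) —

so that on a χ-free tame octahedron the six weights ARE the pattern `u ↦ φ(min over the ≤ 6 feet |v_u − q|)` of an orthonormal frame
(PROVED, `tame_frame`): a point of a COMPACT 20-PARAMETER FAMILY.  The node (0 sorry, glue PROVED):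

  (G_T) ⟸ (Z₀) `SixFeetZeroConeQ` ∧ (S♯) `SixFeetShallowCapQ` ∧ (I₃₆) `SVertexIncidenceQ` ∧ (KX) `CreaseTransitionLedgerQ`

* (Z₀) ZERO CONE [finite-dimensional]: the six-feet pattern has roof value ZERO once all six depths are `≥ d⋆ = 106` — the roof's zero cone
  ABSORBS single-feature CURVATURE, so the whole deep tame bulk of the transition layer (depths `106 … 160` of `80 … 160`) costs NOTHING
  (bridge (Z₀) ⟹ (D) `DeepTameVanishingQ` PROVED);
* (S♯) SHALLOW CAP [finite-dimensional]: a six-feet pattern with a depth `< d⋆` costs `≤ κ` per vertex in the layer (`κ = c_T/60`);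
* (I₃₆) VERTEX INCIDENCE [lattice combinatorics of the exact class]: summed over the shell pairs `(y, z)` with `y` in the motif, the S-vertex
  indicator over the sites of the octahedron of `(y, z)` counts each motif site at most `36` times (`6` octahedra ∋ a site × `6` ordered pole pairs);
  (S♯) ∧ (I₃₆) ⟹ (S) the shallow tame octahedra cost `≤ 6κ ·` (mass of their own layer vertices) — PROVED (`shallowTameCharge_of_cap`);
* (KX) THE RESIDUAL — the CREASE-OR-TRANSITION LEDGER: the roof ledger restricted to the octahedra that are NOT (χ-free and tame) — creases /
  ridges / junction cores of `dist(·, C)` and octahedra touching a χ-transition — with the budget of (G_T) minus the S-charge `6κ · sVertMassL`.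

NEGATIVE KNOWLEDGE (g76 numerics `num/`, full-column LP roof of g75): (i) a split of (G_T) by octahedron classes with GLOBAL CONSTANT budget
shares is DEAD — the worst-case shares do not fit: crease-or-transition class `0.85` (slab void of half-width `118` with its two foot-columns
STARVED by χ-cuts at distance `80–81` from the crease), transition class `0.32` elsewhere (g75 ridge block), shallow class `> 0` elsewhere;
(ii) the same starved slab is a NEAR-MISS of (G_T) ITSELF: total ratio `0.86` (g75's worst was `0.37`) — (G_T) survives with margin `≈ 1.16`
in this family, but the census mark «ROOF-75 ≤ 0.5» is exceeded; (iii) (Z₀): 0 violations among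
9·10⁴ sampled six-feet patterns at depths `≥ 105` for `r_f = 20` (violations of cost `≤ 0.005 c_T` exist at `104.0–104.7`; for `r_f ≥ 40` they
persist to `106`); (S♯): worst `0.0363 c_T` per octahedron at depth `≈ 100.6` (`κ = c_T/60` has margin `2.75`).
-/

noncomputable section

open scoped Classical
open Literature.MathematicalPhysics.StatisticalMechanics Literature.Geometry.DiscreteGeometry
open Summit.AtomisticToContinuum.Crystallization.Theses.PricedLinkCensus
open Summit.AtomisticToContinuum.Crystallization.Theorems.ChargedEnergyGapNegative

namespace Summit.AtomisticToContinuum.Crystallization.Theorems.ChargedEnergyGapChartDial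

/-! ## §1 The selected F-shell functional and its partition calculus (PROVED) -/

section Sel

variable (ϱχ : ℝ) {m : ℕ} (D : Fin m → Set E3) (σ : Fin m → Bool)

/-- The **SELECTED F-SHELL FUNCTIONAL**: `fShellL` restricted to the shell octahedra `(y, z)` satisfying `π y z`. -/
def fShellSel (π : E3 → E3 → Prop) (F : (Fin 3 × Bool → ℝ) → ℝ) (r₁ r₂ τ : ℝ) (P : PeriodicConfiguration 3) (X : Set E3) (ϱ : ℝ)
    (C : Set E3) : ℝ :=
  ∑ y ∈ P.motif, ∑ᶠ z : E3,
    if ((z ∈ P.points ∧ r₁ < dist y z ∧ dist y z ≤ r₂) ∧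
        (OctClean P r₁ X y z ∧ ¬OctPlateau P r₁ (siteW ϱχ D σ X ϱ C) y z)) ∧ π y z then
      (1 / 6) * frameVal F τ (siteW ϱχ D σ X ϱ C) P r₁ y z
    else 0

/-- **χ-FREE octahedron**: no site of the octahedron of `(y, z)` is in transition for any listed set. -/
def OctChiFree (P : PeriodicConfiguration 3) (r₁ : ℝ) (y z : E3) : Prop :=
  ∀ x, InOct P r₁ y z x → transMult ϱχ D x = 0

variable {ϱχ D σ}

/-- **TAME octahedron** (feet diameter `≤ r_f`): the sites of the octahedron admit nearest points of `closure C` lying within `r_f` of each other. -/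
def OctTame (r_f : ℝ) (C : Set E3) (P : PeriodicConfiguration 3) (r₁ : ℝ) (y z : E3) : Prop :=
  ∃ q : E3 → E3, (∀ x, InOct P r₁ y z x → q x ∈ closure C ∧ dist x (q x) = Metric.infDist x C) ∧
    ∀ x x', InOct P r₁ y z x → InOct P r₁ y z x' → dist (q x) (q x') ≤ r_f

/-- **DEEP octahedron**: every site of the octahedron has depth `≥ d⋆`. -/
def OctDeep (dstar : ℝ) (C : Set E3) (P : PeriodicConfiguration 3) (r₁ : ℝ) (y z : E3) : Prop :=
  ∀ x, InOct P r₁ y z x → dstar ≤ Metric.infDist x C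

variable {s : ℝ} {P : PeriodicConfiguration 3}

/-- `fShellL` is the functional selected by `True`. [formal bookkeeping] -/
theorem fShellL_eq_fShellSel (F : (Fin 3 × Bool → ℝ) → ℝ) (r₁ r₂ τ : ℝ) (X : Set E3) (ϱ : ℝ) (C : Set E3) :
    fShellL ϱχ D σ F r₁ r₂ τ P X ϱ C = fShellSel ϱχ D σ (fun _ _ => True) F r₁ r₂ τ P X ϱ C := by
  unfold fShellL fShellSel
  simp only [and_true]

/-- ★ **PARTITION (PROVED)**: if `π ↔ π₁ ∨ π₂` with `π₁, π₂` disjoint then the selected functional splits additively (separated reference). -/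
theorem fShellSel_split {π π₁ π₂ : E3 → E3 → Prop} (hP : IsSeparatedRef s P) (hs : 0 < s)
    (hiff : ∀ y z, π y z ↔ (π₁ y z ∨ π₂ y z)) (hdis : ∀ y z, ¬(π₁ y z ∧ π₂ y z))
    (F : (Fin 3 × Bool → ℝ) → ℝ) (r₁ r₂ τ : ℝ) (X : Set E3) (ϱ : ℝ) (C : Set E3) :
    fShellSel ϱχ D σ π F r₁ r₂ τ P X ϱ C =
      fShellSel ϱχ D σ π₁ F r₁ r₂ τ P X ϱ C + fShellSel ϱχ D σ π₂ F r₁ r₂ τ P X ϱ C := by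
  unfold fShellSel
  rw [← Finset.sum_add_distrib]
  refine Finset.sum_congr rfl fun y _ => ?_
  have hF := hP.finite_inter_closedBall hs y r₂
  set T : Finset E3 := hF.toFinset with hT
  have hmemT : ∀ z, z ∈ P.points → dist y z ≤ r₂ → z ∈ T := fun z hz hd => by
    rw [hT, Set.Finite.mem_toFinset]
    exact ⟨hz, Metric.mem_closedBall.2 (by rw [dist_comm]; exact hd)⟩
  rw [finsum_eq_sum_of_support_subset (s := T), finsum_eq_sum_of_support_subset (s := T),
    finsum_eq_sum_of_support_subset (s := T)]
  · rw [← Finset.sum_add_distrib]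
    refine Finset.sum_congr rfl fun z _ => ?_
    by_cases hA : (z ∈ P.points ∧ r₁ < dist y z ∧ dist y z ≤ r₂) ∧
        (OctClean P r₁ X y z ∧ ¬OctPlateau P r₁ (siteW ϱχ D σ X ϱ C) y z)
    · by_cases h1 : π₁ y z
      · have h2 : ¬π₂ y z := fun h2 => hdis y z ⟨h1, h2⟩
        rw [if_pos ⟨hA, (hiff y z).2 (Or.inl h1)⟩, if_pos ⟨hA, h1⟩, if_neg fun h => h2 h.2, add_zero]
      · by_cases h2 : π₂ y z
        · rw [if_pos ⟨hA, (hiff y z).2 (Or.inr h2)⟩, if_neg fun h => h1 h.2, if_pos ⟨hA, h2⟩, zero_add]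
        · have h0 : ¬π y z := fun h => ((hiff y z).1 h).elim h1 h2
          rw [if_neg fun h => h0 h.2, if_neg fun h => h1 h.2, if_neg fun h => h2 h.2, add_zero]
    · rw [if_neg fun h => hA h.1, if_neg fun h => hA h.1, if_neg fun h => hA h.1, add_zero]
  · intro z hz
    by_contra hzT
    exact (Function.mem_support.1 hz) (if_neg fun h' => hzT (hmemT z h'.1.1.1 h'.1.1.2.2))
  · intro z hz
    by_contra hzT
    exact (Function.mem_support.1 hz) (if_neg fun h' => hzT (hmemT z h'.1.1.1 h'.1.1.2.2))
  · intro z hz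
    by_contra hzT
    exact (Function.mem_support.1 hz) (if_neg fun h' => hzT (hmemT z h'.1.1.1 h'.1.1.2.2))

/-- ★ **TERMWISE TRANSFER (PROVED)**: a non-negative termwise majorant `R y z` of the selected summands is a majorant of the selected
functional by the plain shell-pair sum of `R`. [formal bookkeeping] -/
theorem fShellSel_le_of_termwise {π : E3 → E3 → Prop} (hP : IsSeparatedRef s P) (hs : 0 < s) {F : (Fin 3 × Bool → ℝ) → ℝ}
    {r₁ r₂ τ : ℝ} {X : Set E3} {ϱ : ℝ} {C : Set E3} (R : E3 → E3 → ℝ) (hR : ∀ y z, 0 ≤ R y z)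
    (h : ∀ y ∈ P.motif, ∀ z ∈ P.points, r₁ < dist y z → dist y z ≤ r₂ → OctClean P r₁ X y z →
      ¬OctPlateau P r₁ (siteW ϱχ D σ X ϱ C) y z → π y z → (1 / 6) * frameVal F τ (siteW ϱχ D σ X ϱ C) P r₁ y z ≤ R y z) :
    fShellSel ϱχ D σ π F r₁ r₂ τ P X ϱ C ≤
      ∑ y ∈ P.motif, ∑ᶠ z : E3, (if z ∈ P.points ∧ r₁ < dist y z ∧ dist y z ≤ r₂ then R y z else 0) := by
  unfold fShellSel
  refine Finset.sum_le_sum fun y hy => ?_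
  have hF := hP.finite_inter_closedBall hs y r₂
  set T : Finset E3 := hF.toFinset with hT
  have hmemT : ∀ z, z ∈ P.points → dist y z ≤ r₂ → z ∈ T := fun z hz hd => by
    rw [hT, Set.Finite.mem_toFinset]
    exact ⟨hz, Metric.mem_closedBall.2 (by rw [dist_comm]; exact hd)⟩
  rw [finsum_eq_sum_of_support_subset (s := T), finsum_eq_sum_of_support_subset (s := T)]
  · refine Finset.sum_le_sum fun z _ => ?_
    by_cases hc : ((z ∈ P.points ∧ r₁ < dist y z ∧ dist y z ≤ r₂) ∧
        (OctClean P r₁ X y z ∧ ¬OctPlateau P r₁ (siteW ϱχ D σ X ϱ C) y z)) ∧ π y z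
    · rw [if_pos hc, if_pos hc.1.1]
      exact h y hy z hc.1.1.1 hc.1.1.2.1 hc.1.1.2.2 hc.1.2.1 hc.1.2.2 hc.2
    · rw [if_neg hc]
      split_ifs
      · exact hR y z
      · exact le_rfl
  · intro z hz
    by_contra hzT
    exact (Function.mem_support.1 hz) (if_neg fun h' => hzT (hmemT z h'.1 h'.2.2))
  · intro z hz
    by_contra hzT
    exact (Function.mem_support.1 hz) (if_neg fun h' => hzT (hmemT z h'.1.1.1 h'.1.1.2.2))

/-- ★ A selected functional whose every selected frame-infimum is `≤ 0` is `≤ 0`. [formal bookkeeping] -/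
theorem fShellSel_nonpos {π : E3 → E3 → Prop} (hP : IsSeparatedRef s P) (hs : 0 < s) {F : (Fin 3 × Bool → ℝ) → ℝ} {r₁ r₂ τ : ℝ}
    {X : Set E3} {ϱ : ℝ} {C : Set E3}
    (h : ∀ y ∈ P.motif, ∀ z ∈ P.points, r₁ < dist y z → dist y z ≤ r₂ → OctClean P r₁ X y z →
      ¬OctPlateau P r₁ (siteW ϱχ D σ X ϱ C) y z → π y z → frameVal F τ (siteW ϱχ D σ X ϱ C) P r₁ y z ≤ 0) :
    fShellSel ϱχ D σ π F r₁ r₂ τ P X ϱ C ≤ 0 := by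
  have h0 := fShellSel_le_of_termwise (ϱχ := ϱχ) (D := D) (σ := σ) (π := π) hP hs (F := F) (r₁ := r₁) (r₂ := r₂) (τ := τ) (X := X)
    (ϱ := ϱ) (C := C) (fun _ _ => 0) (fun _ _ => le_rfl)
    (fun y hy z hz h1 h2 h3 h4 h5 => by have := h y hy z hz h1 h2 h3 h4 h5; linarith)
  simpa using h0

end Sel

/-! ## §2 Six-feet patterns: the zero cone (Z₀) and the shallow cap (S♯) — statements about the table `T75` and the profile `φ` alone -/

section SixFeet

/-- The SIX-FEET DEPTH of vertex `u` of the frame `(c, f, ρ)`: the distance from the vertex to the nearest of the six feet `q`. -/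
def feetDepth (c : E3) (f : Fin 3 → E3) (ρ : ℝ) (q : Fin 3 × Bool → E3) (u : Fin 3 × Bool) : ℝ :=
  Finset.univ.inf' Finset.univ_nonempty fun u' => dist (octVertex c f ρ u.1 u.2) (q u')

/-- The transition profile as a function of depth: `φ(t) = (1 − S₇(2 − 2t/ϱ))⁴` (`profileWeight` is `φ ∘ dist(·, C)`). -/
def depthProfile (ϱ t : ℝ) : ℝ := (1 - smoothStep (2 - 2 * t / ϱ)) ^ 4

/-- `profileWeight = depthProfile ∘ infDist`. [formal bookkeeping] -/
theorem profileWeight_eq_depthProfile (ϱ : ℝ) (C : Set E3) (x : E3) :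
    profileWeight ϱ C x = depthProfile ϱ (Metric.infDist x C) := rfl

/-- The number of vertices of a six-feet pattern lying in the transition layer `0 < φ < 1`, as a real number. -/
def layerCount (ϱ : ℝ) (c : E3) (f : Fin 3 → E3) (ρ : ℝ) (q : Fin 3 × Bool → E3) : ℝ :=
  ∑ u : Fin 3 × Bool, if 0 < depthProfile ϱ (feetDepth c f ρ q u) ∧ depthProfile ϱ (feetDepth c f ρ q u) < 1 then 1 else 0

/-- ★★ **(Z₀) THE SIX-FEET ZERO CONE** (finite-dimensional): for every half-diagonal `ρ ∈ [ρlo, ρhi]`, every orthonormal frame and every six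
points ("feet") within `r_f` of each other, the depth pattern `u ↦ φ(min_{u'} |v_u − q_{u'}|)` of the six vertices `v_u = c ± ρ fᵢ` has roof value
ZERO as soon as all six depths are `≥ d⋆` — i.e. it lies in the convex cone spanned by the relabelled zero-cost patterns of `T75` (planar profiles
of depth `≥ 103`, boxes of relative spread `≤ 4.5 %`, χ-planar complements).  Twenty real parameters, no configuration.
`num/zjet*.py`: 0 violations among 8·10⁴ structured (two-cluster / ring / line / disc / radial-pair) + 10⁴ random feet patterns + adversarial
depth-climbs at depths `≥ 105` for `r_f = 20` (violations of cost `≤ 0.005 c_T` at `104.0–104.7`; for `r_f ≥ 40` violations persist to `106`).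
[NEW · TRUE-leaning (sampled) · FINITE (semialgebraic, compact parameter box) · INSTRUMENTABLE · ATTACKABLE-M: cell decomposition of the
20-parameter box + one LP membership certificate with slack per cell + Lipschitz bound of `φ ∘ feetDepth`; door [CELL-LP]] -/
def SixFeetZeroConeQ (ρlo ρhi r_f dstar ϱ : ℝ) : Prop :=
  ∀ ρ : ℝ, ρlo ≤ ρ → ρ ≤ ρhi → ∀ (c : E3) (f : Fin 3 → E3), Orthonormal ℝ f → ∀ q : Fin 3 × Bool → E3,
    (∀ u u', dist (q u) (q u') ≤ r_f) → (∀ u, dstar ≤ feetDepth c f ρ q u) →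
      roofVal T75 (fun u => depthProfile ϱ (feetDepth c f ρ q u)) = 0

/-- ★★ **(S♯) THE SIX-FEET SHALLOW CAP** (finite-dimensional): a six-feet pattern (feet within `r_f`) with SOME depth `< d⋆` costs at most `κ` per
vertex in the transition layer: `(τ·2ρ)²·roofVal T75 (pattern) ≤ κ · #{u : 0 < φ(depth_u) < 1}`.  `num/zjet2.py shallow`: worst
`(τ·2ρ)²·roofVal = 0.0363 c_T` (depth `≈ 100.6`, six layer vertices; `≤ 0.003 c_T` below depth `95`, `≈ 10⁻⁶ c_T` for straddlers of depth `80`);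
designate `κ = c_T/60`: margin `2.75`.
[NEW · TRUE-leaning (sampled) · FINITE · INSTRUMENTABLE · ATTACKABLE-M: same cell/LP technology as (Z₀) with value certificates; door [CELL-LP]] -/
def SixFeetShallowCapQ (ρlo ρhi r_f dstar ϱ τ κ : ℝ) : Prop :=
  ∀ ρ : ℝ, ρlo ≤ ρ → ρ ≤ ρhi → ∀ (c : E3) (f : Fin 3 → E3), Orthonormal ℝ f → ∀ q : Fin 3 × Bool → E3,
    (∀ u u', dist (q u) (q u') ≤ r_f) → (∃ u, feetDepth c f ρ q u < dstar) →
      (τ * (2 * ρ)) ^ 2 * roofVal T75 (fun u => depthProfile ϱ (feetDepth c f ρ q u)) ≤ κ * layerCount ϱ c f ρ q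

end SixFeet

/-! ## §3 The classes and their ledgers: (D) deep tame (vanishing), (S) shallow tame (local charge), (KX) creased-or-χ-touching (residual) -/

section Classes

variable (ϱχ : ℝ) {m : ℕ} (D : Fin m → Set E3) (σ : Fin m → Bool)

/-- An **S-HOLE** (shallow tame χ-free clean non-plateau shell octahedron) of the reference. -/
def IsSHole (r_f dstar : ℝ) (P : PeriodicConfiguration 3) (C X : Set E3) (ϱ r₁ r₂ : ℝ) (y z : E3) : Prop :=
  y ∈ P.points ∧ z ∈ P.points ∧ r₁ < dist y z ∧ dist y z ≤ r₂ ∧ OctClean P r₁ X y z ∧ ¬OctPlateau P r₁ (siteW ϱχ D σ X ϱ C) y z ∧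
    (OctChiFree ϱχ D P r₁ y z ∧ OctTame r_f C P r₁ y z) ∧ ¬OctDeep dstar C P r₁ y z

/-- The **S-VERTEX INDICATOR**: `1` at a site outside `X`, in the transition layer, with localisation factor `1`, which is a site of some S-hole. -/
def sVertInd (r_f dstar : ℝ) (P : PeriodicConfiguration 3) (C X : Set E3) (ϱ r₁ r₂ : ℝ) (x : E3) : ℝ :=
  if (x ∉ X ∧ (0 < profileWeight ϱ C x ∧ profileWeight ϱ C x < 1) ∧ localFactor ϱχ D σ x = 1) ∧
      (∃ y z, IsSHole ϱχ D σ r_f dstar P C X ϱ r₁ r₂ y z ∧ InOct P r₁ y z x) then 1 else 0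

/-- The **S-VERTEX MASS** of one period: the number of motif sites that are layer vertices (factor `1`, outside `X`) of S-holes. -/
def sVertMassL (r_f dstar : ℝ) (P : PeriodicConfiguration 3) (C X : Set E3) (ϱ r₁ r₂ : ℝ) : ℝ :=
  ∑ x ∈ P.motif, sVertInd ϱχ D σ r_f dstar P C X ϱ r₁ r₂ x

/-- The **OCTAHEDRAL INCIDENCE SUM** of a site function `g` over the sites of the octahedron of `(y, z)`. -/
def octIncid (g : E3 → ℝ) (P : PeriodicConfiguration 3) (r₁ : ℝ) (y z : E3) : ℝ :=
  ∑ᶠ x : E3, if InOct P r₁ y z x then g x else 0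

variable {ϱχ D σ}

/-- `sVertInd_nonneg` (docstring added by the landing lane; see the module docstring). [formal bookkeeping] -/
theorem sVertInd_nonneg (r_f dstar : ℝ) (P : PeriodicConfiguration 3) (C X : Set E3) (ϱ r₁ r₂ : ℝ) (x : E3) :
    0 ≤ sVertInd ϱχ D σ r_f dstar P C X ϱ r₁ r₂ x := by
  unfold sVertInd
  split_ifs <;> norm_num

/-- The S-vertex mass is part of the shell mass (`sVertMassL ≤ shellMassL`): the S-charge is a haircut of at most `6κ/c_T` of the shell currency
at S-vertices only. [formal bookkeeping] -/
theorem sVertMassL_le_shellMassL (r_f dstar : ℝ) (P : PeriodicConfiguration 3) (C X : Set E3) (ϱ r₁ r₂ : ℝ) :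
    sVertMassL ϱχ D σ r_f dstar P C X ϱ r₁ r₂ ≤ shellMassL ϱχ D σ P X ϱ C := by
  unfold sVertMassL shellMassL
  refine Finset.sum_le_sum fun x _ => ?_
  unfold sVertInd
  split_ifs with h1 h2 h2
  · rw [h1.1.2.2]
  · exact absurd ⟨h1.1.1, h1.1.2.1.1, h1.1.2.1.2⟩ h2
  · exact localFactor_nonneg ϱχ D σ x
  · exact le_rfl

variable (ϱχ D σ) in
/-- The incidence sum of the S-vertex indicator is non-negative. [formal bookkeeping] -/
theorem octIncid_sVertInd_nonneg (r_f dstar : ℝ) (P : PeriodicConfiguration 3) (C X : Set E3) (ϱ r₁ r₂ : ℝ) (y z : E3) :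
    0 ≤ octIncid (sVertInd ϱχ D σ r_f dstar P C X ϱ r₁ r₂) P r₁ y z := by
  unfold octIncid
  refine finsum_nonneg fun x => ?_
  split_ifs
  · exact sVertInd_nonneg _ _ _ _ _ _ _ _ _
  · exact le_rfl

/-- ★★ **(I₃₆) S-VERTEX INCIDENCE** (lattice combinatorics of the exact class): summed over the shell pairs `(y, z)` (`y` in the motif, `z` a
site with `r₁ < |y − z| ≤ r₂`), the incidence sums of the S-vertex indicator over the sites of the octahedron of `(y, z)` count the S-vertex mass
of one period at most `N_I` times.  In the exact cubic class each site is a pole of `12` and an equatorial site of `24` ordered shell pairs: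
`N_I = 36` exactly (periodic double counting over a fundamental domain + the invariance of the indicator under the lattice, which follows from
the invariance binders). [support · TRUE · ATTACKABLE-S/M (periodic Fubini + fcc second-shell count) · INSTRUMENTABLE (one period)] -/
def SVertexIncidenceQ (cls : Set E3 → Prop) (r_f dstar N_I : ℝ) (s lam ℓ ϱ ϱχ r₁ r₂ : ℝ) : Prop :=
  ∀ (P : PeriodicConfiguration 3) (C X : Set E3) (m : ℕ) (D : Fin m → Set E3) (σ : Fin m → Bool),
    IsSeparatedRef s P → IsLabelledRef lam ℓ P → cls P.points → IsInvariantSet P C → IsInvariantSet P X → (∀ i, IsInvariantSet P (D i)) →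
      ∑ y ∈ P.motif, ∑ᶠ z : E3, (if z ∈ P.points ∧ r₁ < dist y z ∧ dist y z ≤ r₂ then
          octIncid (sVertInd ϱχ D σ r_f dstar P C X ϱ r₁ r₂) P r₁ y z else 0) ≤
        N_I * sVertMassL ϱχ D σ r_f dstar P C X ϱ r₁ r₂

/-- ★ **(D) DEEP TAME VANISHING** (intermediate, PROVED from (Z₀) in §4): on every χ-free tame deep clean non-plateau shell octahedron of a
framed reference the frame-infimum of `(τ·2ρ)²·roofVal T75 (W∘vertices)` is `≤ 0` — same nine binders as (G_T) verbatim. -/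
def DeepTameVanishingQ (cls : Set E3 → Prop) (r_f dstar : ℝ) (s lam ℓ τ ϱ ϱχ r₁ r₂ ρlo ρhi : ℝ) : Prop :=
  ∀ (P : PeriodicConfiguration 3) (C X : Set E3) (m : ℕ) (D : Fin m → Set E3) (σ : Fin m → Bool),
    IsSeparatedRef s P → IsLabelledRef lam ℓ P → cls P.points → IsForceFree P → IsSiteStressFree P →
    IsInvariantSet P C → IsInvariantSet P X → (∀ i, IsInvariantSet P (D i)) → IsFramedOct P r₁ r₂ ρlo ρhi →
    ∀ y ∈ P.points, ∀ z ∈ P.points, r₁ < dist y z → dist y z ≤ r₂ →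
      OctClean P r₁ X y z → ¬OctPlateau P r₁ (siteW ϱχ D σ X ϱ C) y z →
      OctChiFree ϱχ D P r₁ y z → OctTame r_f C P r₁ y z → OctDeep dstar C P r₁ y z →
        frameVal (roofVal T75) τ (siteW ϱχ D σ X ϱ C) P r₁ y z ≤ 0

/-- ★ **(S) SHALLOW TAME CHARGE** (intermediate, PROVED from (S♯) ∧ (I₃₆) in §4): the roof ledger restricted to the S-holes is at most `6κ` times
the S-vertex mass — same nine binders as (G_T) verbatim. -/
def ShallowTameChargeQ (cls : Set E3 → Prop) (r_f dstar κ : ℝ) (s lam ℓ τ ϱ ϱχ r₁ r₂ ρlo ρhi : ℝ) : Prop :=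
  ∀ (P : PeriodicConfiguration 3) (C X : Set E3) (m : ℕ) (D : Fin m → Set E3) (σ : Fin m → Bool),
    IsSeparatedRef s P → IsLabelledRef lam ℓ P → cls P.points → IsForceFree P → IsSiteStressFree P →
    IsInvariantSet P C → IsInvariantSet P X → (∀ i, IsInvariantSet P (D i)) → IsFramedOct P r₁ r₂ ρlo ρhi →
      fShellSel ϱχ D σ (fun y z => (OctChiFree ϱχ D P r₁ y z ∧ OctTame r_f C P r₁ y z) ∧ ¬OctDeep dstar C P r₁ y z)
          (roofVal T75) r₁ r₂ τ P X ϱ C ≤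
        6 * κ * sVertMassL ϱχ D σ r_f dstar P C X ϱ r₁ r₂

/-- ★★★ **(KX) THE CREASE-OR-TRANSITION LEDGER** — THE RESIDUAL of NODE 76: the roof ledger restricted to the shell octahedra that are NOT
(χ-free and tame) — the CREASED octahedra (feet seeing two features `> r_f` apart: folds, ridges, junction cores of the cut locus of `dist(·, C)`)
and the octahedra TOUCHING A χ-TRANSITION — paid by the budget of (G_T) minus the S-charge: `c_T·shellMassL − 6κ·sVertMassL + cχ·transMassL
+ c_H·pricedNearCountL` (`sVertMassL ≤ shellMassL`; in the worst family below `sVertMassL ≈ 0`).  The costly objects are codimension-one: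
CREASES of `dist(·, C)` (worst: the mid-plane of a slab void of half-width `119`, local ratio `0.383` against its two foot columns, full-LP roof;
V-folds of half-angle `≤ 16°` free; single-feature curvature free) and creases of `dist(·, Dᵢ)` (g75 chislab `0.164`), and their COUPLING: a
χ-cut at distance `≈ 80` from a `C`-crease STARVES the crease's foot columns (localisation factor `→ 0` on them) while the `cχ`-currency of the
cut's transition sites (`w ≤ 0.04` there) compensates only partly — `num/slabscan.py`: total ratio `0.86` at half-width `118`, cuts at `80–81`
(worst found; g75's worst `0.37`).  [residual · NEW as typed · UNDECIDED → TRUE-leaning (margin `≈ 1.16` in the worst family found) ·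
INSTRUMENTABLE · IDEA-NEEDED → ATTACKABLE-L; door [BEAM]: a typed TRANSPORT — (F) a finite FOLD/RIDGE-CHARGE TABLE (cost of a creased six-feet-pair
pattern `≤ Φ(depth, fold angle)`, LP certificates) ∧ (B) the BEAM INEQUALITY (characteristics from creased octahedra to their feet do not cross;
two-currency mass along them `≥ Φ`) — lattice distance geometry + the profile arithmetic of `φ`, `φχ`] -/
def CreaseTransitionLedgerQ (cls : Set E3 → Prop) (r_f dstar κ : ℝ) (s lam ℓ τ ϱ ϱχ r₁ r₂ ρlo ρhi c_T cχ : ℝ) : Prop :=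
  ∃ c_H : ℝ, 0 ≤ c_H ∧ ∀ (P : PeriodicConfiguration 3) (C X : Set E3) (m : ℕ) (D : Fin m → Set E3) (σ : Fin m → Bool),
    IsSeparatedRef s P → IsLabelledRef lam ℓ P → cls P.points → IsForceFree P → IsSiteStressFree P →
    IsInvariantSet P C → IsInvariantSet P X → (∀ i, IsInvariantSet P (D i)) → IsFramedOct P r₁ r₂ ρlo ρhi →
      fShellSel ϱχ D σ (fun y z => ¬(OctChiFree ϱχ D P r₁ y z ∧ OctTame r_f C P r₁ y z)) (roofVal T75) r₁ r₂ τ P X ϱ C ≤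
        c_T * shellMassL ϱχ D σ P X ϱ C - 6 * κ * sVertMassL ϱχ D σ r_f dstar P C X ϱ r₁ r₂ + cχ * transMassL ϱχ D σ P X ϱ C +
          c_H * (pricedNearCountL ϱχ D σ P X ϱ C : ℝ)

/-- ★★★ **GLUE OF NODE 76 FROM THE CLASSES (PROVED)**: (D) ∧ (S) ∧ (KX) ⟹ (G_T) `RoofLedgerQ` (same constants; any separation `s > 0`).
The three classes `¬(cf ∧ tm)`, `(cf ∧ tm) ∧ ¬dp`, `(cf ∧ tm) ∧ dp` PARTITION the clean non-plateau shell octahedra; the budgets add up exactly. -/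
theorem roofLedgerQ_of_classes {cls : Set E3 → Prop} {r_f dstar κ s lam ℓ τ ϱ ϱχ r₁ r₂ ρlo ρhi c_T cχ : ℝ} (hs : 0 < s)
    (hD : DeepTameVanishingQ cls r_f dstar s lam ℓ τ ϱ ϱχ r₁ r₂ ρlo ρhi)
    (hS : ShallowTameChargeQ cls r_f dstar κ s lam ℓ τ ϱ ϱχ r₁ r₂ ρlo ρhi)
    (hKX : CreaseTransitionLedgerQ cls r_f dstar κ s lam ℓ τ ϱ ϱχ r₁ r₂ ρlo ρhi c_T cχ) :
    RoofLedgerQ cls s lam ℓ τ ϱ ϱχ r₁ r₂ ρlo ρhi c_T cχ := by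
  obtain ⟨cH, hcH, hKX⟩ := hKX
  refine ⟨cH, hcH, fun P C X m D σ h1 h2 hcl h3 h4 h6 h7 h11 hFr => ?_⟩
  have eS := hS P C X m D σ h1 h2 hcl h3 h4 h6 h7 h11 hFr
  have eKX := hKX P C X m D σ h1 h2 hcl h3 h4 h6 h7 h11 hFr
  -- the partition: all = KX ⊔ A;  A = S ⊔ D  (A = χ-free ∧ tame)
  have s1 := fShellSel_split (ϱχ := ϱχ) (D := D) (σ := σ) (π := fun _ _ => True)
    (π₁ := fun y z => ¬(OctChiFree ϱχ D P r₁ y z ∧ OctTame r_f C P r₁ y z))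
    (π₂ := fun y z => OctChiFree ϱχ D P r₁ y z ∧ OctTame r_f C P r₁ y z) h1 hs
    (fun y z => by simpa using (em (OctChiFree ϱχ D P r₁ y z ∧ OctTame r_f C P r₁ y z)).symm) (fun y z h => h.1 h.2)
    (roofVal T75) r₁ r₂ τ X ϱ C
  have s2 := fShellSel_split (ϱχ := ϱχ) (D := D) (σ := σ) (π := fun y z => OctChiFree ϱχ D P r₁ y z ∧ OctTame r_f C P r₁ y z)
    (π₁ := fun y z => (OctChiFree ϱχ D P r₁ y z ∧ OctTame r_f C P r₁ y z) ∧ ¬OctDeep dstar C P r₁ y z)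
    (π₂ := fun y z => (OctChiFree ϱχ D P r₁ y z ∧ OctTame r_f C P r₁ y z) ∧ OctDeep dstar C P r₁ y z) h1 hs
    (fun y z => by constructor
                   · intro h; by_cases hd : OctDeep dstar C P r₁ y z
                     · exact Or.inr ⟨h, hd⟩
                     · exact Or.inl ⟨h, hd⟩
                   · rintro (h | h) <;> exact h.1)
    (fun y z h => h.1.2 h.2.2) (roofVal T75) r₁ r₂ τ X ϱ C
  -- the deep tame class vanishes
  have eD : fShellSel ϱχ D σ (fun y z => (OctChiFree ϱχ D P r₁ y z ∧ OctTame r_f C P r₁ y z) ∧ OctDeep dstar C P r₁ y z)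
      (roofVal T75) r₁ r₂ τ P X ϱ C ≤ 0 :=
    fShellSel_nonpos h1 hs fun y hy z hz hd1 hd2 hc hp hπ =>
      hD P C X m D σ h1 h2 hcl h3 h4 h6 h7 h11 hFr y (P.mem_points_of_mem_motif hy) z hz hd1 hd2 hc hp hπ.1.1 hπ.1.2 hπ.2
  rw [fShellL_eq_fShellSel, s1, s2]
  linarith

end Classes

end Summit.AtomisticToContinuum.Crystallization.Theorems.ChargedEnergyGapChartDial
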